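import Summits.BirchSwinnertonDyer.Rank1Residual.Additive.GordChiBranchKatoComponent
import Summits.BirchSwinnertonDyer.Rank1Residual.Additive.GordRatMainConjLowerBound
import Summits.BirchSwinnertonDyer.Rank1Residual.Additive.TypeGIntegralJ
import Summits.BirchSwinnertonDyer.Rank1Residual.GaloisImage.JWitnessTowerSurjectivity
import Literature.NumberTheory.EllipticCurves.Kato2004.BigImageDivisibilityCyclotomicPrimeComponentOfHalf
import Literature.NumberTheory.EllipticCurves.Kato2004.Condition1252SemistableProofs
import Literature.NumberTheory.EllipticCurves.PAdicBSDSkinnerUrbanProofs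
import Literature.NumberTheory.EllipticCurves.CyclotomicIwasawaMainTheoremIrreducibleBaseChangeProofs
import HarnessLib

/-!
# The located gap of T-N10R in its NATIVE shape, EVEN branch (`p ≡ 1 (mod 4)`): the RATIONAL one-sided
# Skinner–Urban containment `char_Λ X ⊆ (L_p(f♭, α, ω^{(p−1)/2}))` in `Λ ⊗ ℚ_p` — typed; and Kato's
# printed half upgrades it to the rational branch main conjecture `ChiBranchRatCharEqAt`
# (cell `b2b-bsdres`, team n1011, seat n1011-p06 gen 2, OWNERS row T-N10R, phase 4, even twin)

HONEST FRAMING (cell `b2b-bsdres`, run/shared/lean/b2b/bsd-rank1-residual/, verbatim in every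
file): the goal of the cell is to DELETE the COMBINATION-SHAPED residual classes of the
Birch–Swinnerton-Dyer formula for ALL analytic-rank `≤ 1` elliptic curves over `ℚ` — "full BSD
formula for every rank `≤ 1` curve in class `C`" assembled STRICTLY from published theorems — so
that the rank-`≤ 1` remainder becomes exactly the CONSTRUCTION-SHAPED classes, which are TYPED
(missing-input `Prop`s), NOT attempted. This is not "finishing BSD". Team n1011 (X4 ∧ `p = 3` / the
additive block, §I items N10 / N11): research routes; prove what is provable now; no claim beyond
the stated classes; X4♯(G-ord) stays CONSTRUCTION-SHAPED; labels / census / located gap UNCHANGED;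
nothing is booked. ONE definition (a typed input, nothing asserted) and theorems; no new named fact
(the Literature inputs are the explicit binders `hKW`, `hDel`, `hDel98`, `hPal`).

## What and why

Even twin of `ChiBranchRatLowerDvdOdd.lean` (same seat): on the defect-2 rows at a prime
`p ≡ 1 (mod 4)` the additive curve is `E = E♭ ⊗ χ_p`, `χ_p = ω^{(p−1)/2}` EVEN, and the relevant branch
of the good-ordinary twist `E♭` is the PLUS branch `padicLFunctionBranch f♭ α (p/2)` (MTT §I.13) with
Néron normalisation `ϖ · Ω_{E♭} = Ω⁺_f`. Row T-N10R's typed input here is the rational EQUALITY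
`ChiBranchRatCharEqAt W p` (`GordRatMainConjLowerBound.lean`, p249422); ONE of its two containments is
IN PRINT (Kato 2004 Thm. 17.4 (3), component `(p−1)/2`, via the half-eigenspace reading
`Wuthrich2014.kato_halfEigenCharIdeal_dvd_cyclotomicPrime_of_surjective` and
`Kato2004.charIdeal_dvd_padicLFunctionBranch_component_of_surjective_of_half`, transported to
`X(W/ℚ_∞)` as in additive-p2's even Brick 5′ `chiBranchLeadingTermBigImageAt_of_katoComponent`, which
exported only the `T = 0` shadow); the OTHER — `char_Λ X ⊆ (ϖ L_p)` in `Λ ⊗ ℚ_p`, Skinner–Urban's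
direction and native currency (SU 2014 Cor. 3.6.2 / Thm. 3.6.4: "in `Λ_{ℚ,O_L} ⊗_{ℤ_p} ℚ_p`") — is
the located gap. So:

* §0 TYPED: `ChiBranchRatLowerDvdAt W p` — every `g ∈ char_Λ X(W/ℚ_∞)` has `p^m g ∈ (G)`,
  `ι G = p^n · ϖ · L_p(f, α, ω^{(p−1)/2}, T)`. Nothing asserted. Weaker than the typed inputs already
  in the tree on this locus (this seat's `ChiBranchRatCharEqAt`; n1011-p07's `ChiBranchLowerDivisibilityAt`;
  n1011-p10's `QuadraticBranchLowerDivisibilityAt`).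
* §1 KERNEL: Kato's half on `X(W/ℚ_∞)` as a full power-series identity.
* §2 KERNEL (the split): §1 + §0 + the tower of `W` ⟹ `ChiBranchRatCharEqAt W p`
  (`exists_span_eq_and_map_eq_C_zpow_mul`, the bookkeeping of SU Thm. 3.6.4, p. 43).
* §3 ENDS on X4♯(G-ord) ∩ `I₀*` ∩ surj(p), `p ≥ 5`, `p ≡ 1 (mod 4)` (tower from surj(p) by Serre,
  `forall_hasSurjectiveModNGaloisRep_pow_of_surj_of_five_le_or_semistable`, PROVED in the tree):
  `ChiBranchRatLowerDvdAt W p` + ONE unit coefficient ⟹ (p249422) the LOWER half off the anomalous rows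
  and `BSD(E,p)` — the typed input is the one-sided rational containment and NOTHING ELSE typed.

X4♯(G-ord) stays CONSTRUCTION-SHAPED; located gap unchanged in substance; nothing booked; no label change.

References: C. Skinner, E. Urban, Invent. Math. 195 (2014) Cor. 3.6.2 (p. 42), Thm. 3.6.4 and its
proof (p. 43) [SkinnerUrban2014]; K. Kato, Astérisque 295 (2004) Thm. 17.4 (3) (p. 273), (12.5.2)
(p. 222) [Kato2004Asterisque]; C. Wuthrich, J. London Math. Soc. 90 (2014) §3 (p. 390) [Wuthrich2014];
J.-P. Serre, Invent. Math. 15 (1972) / *Abelian ℓ-adic representations* IV-23 [SerreAbelianLadic1968];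
Mazur–Tate–Teitelbaum, Invent. Math. 84 (1986) §I.12–I.14 [MazurTateTeitelbaum1986Invent];
R. Greenberg, LNM 1716 (1999) §5 (p. 143) [GreenbergLNM1716]; A. Pal, Proc. AMS (2012) Thm. 3.2
[Pal2012]; D. Delbourgo, J. Number Theory 95 (2002) Theorem (A), (B) (p. 40) [Delbourgo2002];
D. Delbourgo, Compositio Math. 113 (1998) Prop. 4 (p. 144) [Delbourgo1998]; R. L. Miller, LMS J.
Comput. Math. 14 (2011) Def. 1.1 [Miller2011LMS]; Burungale–Castella–Skinner, IMRN 2025 Thm. 1.1.2 (a)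
(shape only) [BurungaleCastellaSkinner2025].
-/

noncomputable section

open scoped Classical MatrixGroups ModularForm NumberField

open CongruenceSubgroup WeierstrassCurve NumberField Literature.NumberTheory.EllipticCurves
  Literature.NumberTheory.EllipticCurves.ModularForms
  Literature.NumberTheory.EllipticCurves.Rank1Residual
  Literature.NumberTheory.EllipticCurves.Rank1Residual.Typed
  Literature.NumberTheory.GaloisRepresentations
  IsDedekindDomain

namespace Summit.BirchSwinnertonDyer.Rank1Residual.Additive

/-! ### §0 The typed input: the one-sided RATIONAL Skinner–Urban containment on the even branch -/

/-- **The Skinner–Urban direction of the `ω^{(p−1)/2}`-branch (EVEN) cyclotomic main conjecture of the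
good-ordinary twist, RATIONALLY, TYPED** (`p ≡ 1 (mod 4)`). For the additive curve `E = W` (globally
minimal): whenever `W = C • V^{(p)}` for a globally minimal `V = E♭` good ordinary at `p` with newform
`f`, `κ`/`γ` is the cyclotomic `ℤ_p`-extension with a generator matching the cyclotomic variable, `D`
is a `Λ`-dual datum of `Sel_{p^∞}(W/ℚ_∞)` and `ϖ · Ω_V = Ω⁺_f`, EVERY `g ∈ char_Λ X(W/ℚ_∞)` lies in
`(ϖ · L_p(f, α, ω^{(p−1)/2}, T)) · (Λ ⊗_{ℤ_p} ℚ_p)`: `p^m · g ∈ (G)` for some `G ∈ Λ`, `m n ∈ ℕ`, with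
`ι G = p^n · ϖ · L_p(f, α, ω^{(p−1)/2}, T)` (`α = unitRoot V p`, the EVEN branch on the plus symbols,
MTT §I.13; `ι : Λ ↪ ℚ_p⟦T⟧`). This is the SHAPE of Skinner–Urban 2014 Cor. 3.6.2 / Thm. 3.6.4 (first
display, "in `Λ_{ℚ,O_L} ⊗_{ℤ_p} ℚ_p`") on the `χ_p`-branch of the twist — printed there for the trivial
branch only. OPEN — OUR typed missing input (`@[conjecture]`, a predicate on `(W, p)`); nothing asserted.
[cite: SkinnerUrban2014, Cor. 3.6.2 (p. 42) and Thm. 3.6.4 (p. 43) (shape only; nothing asserted)]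
[cite: MazurTateTeitelbaum1986Invent, §I.12–I.13 (shape only; nothing asserted)] -/
@[conjecture] def ChiBranchRatLowerDvdAt (W : WeierstrassCurve ℚ) (p : ℕ) [Fact p.Prime] : Prop :=
  ∀ (V : WeierstrassCurve ℚ) [V.IsElliptic] [V.IsGloballyMinimal]
    {κ : ZpExtension ℚ p} {γ : Field.absoluteGaloisGroup ℚ} {N : ℕ} [NeZero N]
    {f : CuspForm (Gamma0 N) 2},
    p % 4 = 1 →
    (∃ C : VariableChange ℚ, C • V.quadraticTwist (p : ℚ) = W) →
    GoodOrd V p →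
    κ.IsCyclotomic → κ.IsTopGenerator γ → IsCyclotomicVariable p γ → IsNewformOf V f →
    ∀ (D : W.SelmerDualData κ γ) (ϖ : ℚ), (ϖ : ℝ) * V.realPeriodRat = plusPeriod f →
      ∀ g ∈ D.charIdeal, ∃ (G : IwasawaAlgebra p) (m n : ℕ),
        PowerSeries.C ((p : ℤ_[p]) ^ m) * g ∈ Ideal.span {G} ∧
        iwasawaToPowerSeries p G =
          PowerSeries.C ((p : ℚ_[p]) ^ n) *
            (PowerSeries.C (ϖ : ℚ_[p]) * padicLFunctionBranch f (unitRoot V p : ℚ_[p]) (p / 2))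

/-- Unfolding lemma for `ChiBranchRatLowerDvdAt` (to apply the predicate as a function). -/
theorem chiBranchRatLowerDvdAt_iff (W : WeierstrassCurve ℚ) (p : ℕ) [Fact p.Prime] :
    ChiBranchRatLowerDvdAt W p ↔
      ∀ (V : WeierstrassCurve ℚ) [V.IsElliptic] [V.IsGloballyMinimal]
        {κ : ZpExtension ℚ p} {γ : Field.absoluteGaloisGroup ℚ} {N : ℕ} [NeZero N]
        {f : CuspForm (Gamma0 N) 2},
        p % 4 = 1 →
        (∃ C : VariableChange ℚ, C • V.quadraticTwist (p : ℚ) = W) →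
        GoodOrd V p →
        κ.IsCyclotomic → κ.IsTopGenerator γ → IsCyclotomicVariable p γ → IsNewformOf V f →
        ∀ (D : W.SelmerDualData κ γ) (ϖ : ℚ), (ϖ : ℝ) * V.realPeriodRat = plusPeriod f →
          ∀ g ∈ D.charIdeal, ∃ (G : IwasawaAlgebra p) (m n : ℕ),
            PowerSeries.C ((p : ℤ_[p]) ^ m) * g ∈ Ideal.span {G} ∧
            iwasawaToPowerSeries p G =
              PowerSeries.C ((p : ℚ_[p]) ^ n) *
                (PowerSeries.C (ϖ : ℚ_[p]) * padicLFunctionBranch f (unitRoot V p : ℚ_[p]) (p / 2)) :=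
  Iff.rfl

/-- **The rational EQUALITY implies the one-sided rational containment** (trivial direction;
`k ≥ 0`: `G = g₀`, `m = 0`, `n = k`; `k < 0`: `G = p^{−k} g₀`, `m = −k`, `n = 0`). Bookkeeping.
[cite: SkinnerUrban2014, Thm. 3.6.4 (p. 43) (shape only)] -/
theorem chiBranchRatLowerDvdAt_of_ratCharEq (W : WeierstrassCurve ℚ) (p : ℕ) [hp : Fact p.Prime]
    (h : ChiBranchRatCharEqAt W p) : ChiBranchRatLowerDvdAt W p := by
  intro V _ _ κ γ N _ f hp1 hCW hV hκ hγ hcv hf D ϖ hϖ g hg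
  obtain ⟨-, g₀, k, hchar, hι⟩ := h V hp1 hCW hV hκ hγ hcv hf D ϖ hϖ
  have hp0 : (p : ℚ_[p]) ≠ 0 := Nat.cast_ne_zero.mpr hp.out.ne_zero
  rw [hchar] at hg
  obtain ⟨s, rfl⟩ := Ideal.mem_span_singleton'.mp hg
  rcases le_or_gt 0 k with hk | hk
  · obtain ⟨n, rfl⟩ : ∃ n : ℕ, k = n := ⟨k.toNat, (Int.toNat_of_nonneg hk).symm⟩
    refine ⟨g₀, 0, n, ?_, ?_⟩
    · rw [pow_zero, map_one, one_mul]
      exact Ideal.mem_span_singleton'.mpr ⟨s, rfl⟩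
    · rw [hι, zpow_natCast, map_mul, mul_assoc]
  · obtain ⟨m, hm⟩ : ∃ m : ℕ, -k = m := ⟨(-k).toNat, (Int.toNat_of_nonneg (by omega)).symm⟩
    refine ⟨PowerSeries.C ((p : ℤ_[p]) ^ m) * g₀, m, 0, ?_, ?_⟩
    · exact Ideal.mem_span_singleton'.mpr ⟨s, by ring⟩
    · rw [map_mul, hι, iwasawaToPowerSeries_C_natCast_pow, pow_zero, map_one, one_mul, ← mul_assoc,
        ← map_mul, ← mul_assoc, ← zpow_natCast, ← hm, ← zpow_add₀ hp0, neg_add_cancel, zpow_zero,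
        one_mul]

/-! ### §1 Kato's half on `X(E/ℚ_∞)` — the full series, even branch -/

section KatoHalf

variable (W : WeierstrassCurve ℚ) [W.IsElliptic] (p : ℕ) [hp : Fact p.Prime]

/-- **Kato's half of the even-branch main conjecture, on the additive curve's `X(E/ℚ_∞)`, as a power
series identity.** For `W/ℚ` potentially good at `p ≡ 1 (mod 4)` (`0 ≤ ord_p j(W)`), every globally
minimal `V`, good ordinary or multiplicative at `p` (the multiplicative case is vacuous), with
`C • V^{(p)} = W`, `ρ_{V,p^∞}` onto at every level, every cyclotomic `κ/γ` matching the cyclotomic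
variable, newform `f` of `V`, `Λ`-dual datum `D` of `Sel_{p^∞}(W/ℚ_∞)` and `ϖ · Ω_V = Ω⁺_f`:
`X(W/ℚ_∞)` is `Λ`-torsion and some `g ∈ char_Λ X(W/ℚ_∞)` has `ι g = u · ϖ · L_p(f, α, ω^{(p−1)/2}, T)`,
`u ∈ ℤ_pˣ` — additive-p2's even Brick 5′ stopped BEFORE the constant term, over `hKW` via
`…_component_of_surjective_of_half`. [cite: Kato2004Asterisque, Thm. 17.4 (3) (p. 273), (12.5.2) (p. 222)]
[cite: Wuthrich2014, §3 (p. 390)] [cite: GreenbergLNM1716, §5 p. 143] [cite: MazurTateTeitelbaum1986Invent, §I.13] -/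
theorem exists_mem_charIdeal_map_eq_unit_mul_branch_of_katoHalf
    (hKW : Wuthrich2014.kato_halfEigenCharIdeal_dvd_cyclotomicPrime_of_surjective)
    (hj : 0 ≤ padicValRat p W.j)
    (V : WeierstrassCurve ℚ) [V.IsElliptic] [V.IsGloballyMinimal]
    {κ : ZpExtension ℚ p} {γ : Field.absoluteGaloisGroup ℚ} {N : ℕ} [NeZero N]
    {f : CuspForm (Gamma0 N) 2} (hp1 : p % 4 = 1)
    (hCW : ∃ C : VariableChange ℚ, C • V.quadraticTwist (p : ℚ) = W) (hred : GoodOrd V p ∨ Mult V p)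
    (hsurj : ∀ n : ℕ, V.HasSurjectiveModNGaloisRep (p ^ n : ℕ))
    (hκ : κ.IsCyclotomic) (hγ : κ.IsTopGenerator γ) (hcv : IsCyclotomicVariable p γ)
    (hf : IsNewformOf V f) (D : W.SelmerDualData κ γ) (ϖ : ℚ)
    (hϖ : (ϖ : ℝ) * V.realPeriodRat = plusPeriod f) :
    D.IsTorsion ∧ ∃ g ∈ D.charIdeal, ∃ u : ℤ_[p]ˣ,
      iwasawaToPowerSeries p g =
        PowerSeries.C (((u : ℤ_[p]) : ℚ_[p]) * (ϖ : ℚ_[p])) *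
          padicLFunctionBranch f (unitRoot V p : ℚ_[p]) (p / 2) := by
  have hK := Kato2004.charIdeal_dvd_padicLFunctionBranch_component_of_surjective_of_half hKW
  have hp2 : p ≠ 2 := by rintro rfl; norm_num at hp1
  have hpne : (p : ℚ) ≠ 0 := Nat.cast_ne_zero.mpr hp.out.ne_zero
  have heven : Even (p / 2) := ⟨p / 4, by omega⟩
  have hord : IsOrdinaryAt V p := isOrdinaryAt_of_goodOrd_or_mult_of_model_twist W V hpne hCW hj hred
  obtain ⟨C, hC⟩ := hCW
  haveI hcycL : IsCyclotomicExtension {p} ℚ (CyclotomicField p ℚ) := by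
    have h : (CyclotomicField.algebra p ℚ : Algebra ℚ (CyclotomicField p ℚ)) =
        DivisionRing.toRatAlgebra := Subsingleton.elim _ _
    exact h ▸ CyclotomicField.isCyclotomicExtension p ℚ
  obtain ⟨K, θ, hK2, hθ, hθ2⟩ := exists_intermediateField_sq_eq_pStar p (CyclotomicField p ℚ) hp2
  haveI : NumberField K := NumberField.of_module_finite ℚ K
  have hcK : θ ^ 2 = algebraMap ℚ K (p : ℚ) := by
    rw [hθ2, pStar_eq_self_of_mod_four_eq_one hp1]
  haveI : IsGalois ℚ K := isGalois_of_finrank_eq_two K hK2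
  haveI := normal_galRange K hK2 (sigmaQ_ne_one K hK2 hθ hcK)
  haveI := normal_galRange_cyclotomic p (CyclotomicField p ℚ)
  haveI : (V.quadraticTwist (p : ℚ)).IsElliptic := V.isElliptic_quadraticTwist hpne
  obtain ⟨γ', hγ'KF, hκγ', ⟨g₀, hg₀, hγ'eq⟩, D', hchar, htor⟩ :=
    SelmerDualData.exists_chiEigenInCyclotomic p (CyclotomicField p ℚ) V K hK2 hθ hcK κ hC hp2 D
  obtain ⟨htorX, g, hgmem, u, hιg⟩ := hK p V K (CyclotomicField p ℚ) (κ := κ) (γ := γ') (f := f)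
    (chiEigenSelmerIn V K p κ (galRange (K := ℚ) (CyclotomicField p ℚ)))
    (fun t ht ↦ conjH1_mem_chiEigenSelmerIn γ' ht) D'.X D'.toDual hp2 hK2 ⟨θ, hθ2⟩ hord hsurj hκ
    (isTopGenerator_of_kappa_eq κ hκγ' hγ)
    (isCyclotomicVariable_of_eq_mul p κ hκ hg₀ hγ'eq hcv)
    (Subgroup.mem_inf.mp hγ'KF).1 (Subgroup.mem_inf.mp hγ'KF).2 hf
    (mem_chiEigenSelmerIn_iff_ite V K κ _) D'.bijective D'.toDual_T_smul D'.toDual_C_smul ϖ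
    (by rw [if_pos heven]; exact hϖ)
  refine ⟨htor.mp htorX, g, hchar ▸ hgmem, u, ?_⟩
  rw [hιg, if_pos heven]

end KatoHalf

/-! ### §2 The split: Kato's half + the typed one-sided containment = the rational branch MC -/

section Split

variable {W : WeierstrassCurve ℚ} [W.IsElliptic] {p : ℕ} [hp : Fact p.Prime]

/-- **Kato's printed half + the typed RATIONAL Skinner–Urban containment ⟹ the rational even-branch
main conjecture `ChiBranchRatCharEqAt W p`**, for `W/ℚ` with `0 ≤ ord_p j(W)` and `ρ̄_{W,p^n}` onto for
all `n` (transported to the twist by `GaloisImage.hasSurjectiveModNGaloisRep_pow_iff_of_model_twist`);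
two divisibilities in `Λ ⊗ ℚ_p` give a generator `g'` with `ι g' = p^k ϖ L_p`
(`exists_span_eq_and_map_eq_C_zpow_mul`, the bookkeeping of SU Thm. 3.6.4, p. 43).
[cite: SkinnerUrban2014, Thm. 3.6.4, proof (p. 43)] [cite: Kato2004Asterisque, Thm. 17.4 (3) (p. 273)] -/
theorem chiBranchRatCharEqAt_of_katoHalf_of_ratLowerDvd
    (hKW : Wuthrich2014.kato_halfEigenCharIdeal_dvd_cyclotomicPrime_of_surjective)
    (hj : 0 ≤ padicValRat p W.j) (htower : ∀ n : ℕ, W.HasSurjectiveModNGaloisRep (p ^ n : ℕ))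
    (hE : ChiBranchRatLowerDvdAt W p) : ChiBranchRatCharEqAt W p := by
  intro V _ _ κ γ N _ f hp1 hCW hV hκ hγ hcv hf D ϖ hϖ
  have hpne : (p : ℚ) ≠ 0 := Nat.cast_ne_zero.mpr hp.out.ne_zero
  have hsurjV : ∀ n : ℕ, V.HasSurjectiveModNGaloisRep (p ^ n : ℕ) := fun n ↦
    (GaloisImage.hasSurjectiveModNGaloisRep_pow_iff_of_model_twist V p hpne hCW n).mp (htower n)
  obtain ⟨htor, g₁, hg₁, u, hιg₁⟩ :=
    exists_mem_charIdeal_map_eq_unit_mul_branch_of_katoHalf W p hKW hj V hp1 hCW (Or.inl hV) hsurjV hκ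
      hγ hcv hf D ϖ hϖ
  obtain ⟨g, hchar, -⟩ := exists_charIdeal_eq_span_singleton p D
  obtain ⟨G, m, n, hG, hιG⟩ := hE V hp1 hCW hV hκ hγ hcv hf D ϖ hϖ g
    (by rw [hchar]; exact Ideal.mem_span_singleton_self g)
  have hg₁' : PowerSeries.C ((u⁻¹ : ℤ_[p]ˣ) : ℤ_[p]) * g₁ ∈ Ideal.span {g} := by
    rw [← hchar]; exact Ideal.mul_mem_left _ _ hg₁
  have hCu : iwasawaToPowerSeries p (PowerSeries.C ((u⁻¹ : ℤ_[p]ˣ) : ℤ_[p])) =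
      PowerSeries.C ((((u⁻¹ : ℤ_[p]ˣ) : ℤ_[p]) : ℚ_[p])) := by
    rw [PowerSeries.map_C, PadicInt.algebraMap_apply]
  have hu0 : (((u : ℤ_[p]) : ℚ_[p])) ≠ 0 := by
    intro h0
    have h1 : (((u⁻¹ : ℤ_[p]ˣ) : ℤ_[p]) : ℚ_[p]) * (((u : ℤ_[p]) : ℚ_[p])) = 1 := by
      rw [← PadicInt.coe_mul, Units.inv_mul, PadicInt.coe_one]
    rw [h0, mul_zero] at h1
    exact zero_ne_one h1
  have hιg₁' : iwasawaToPowerSeries p (PowerSeries.C ((u⁻¹ : ℤ_[p]ˣ) : ℤ_[p]) * g₁) =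
      PowerSeries.C ((p : ℚ_[p]) ^ (0 : ℕ)) *
        (PowerSeries.C (ϖ : ℚ_[p]) * padicLFunctionBranch f (unitRoot V p : ℚ_[p]) (p / 2)) := by
    rw [pow_zero, map_one, one_mul, map_mul, hιg₁, hCu, ← mul_assoc, ← map_mul, coe_units_inv_eq_inv,
      ← mul_assoc, inv_mul_cancel₀ hu0, one_mul]
  obtain ⟨g', k, hspan, hιg'⟩ := exists_span_eq_and_map_eq_C_zpow_mul p hg₁' hιg₁' hG hιG
  refine ⟨htor, g', k, hchar.trans hspan, ?_⟩
  rw [hιg', map_mul, mul_assoc]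

/-- **X4♯(G-ord) ∩ `I₀*` ∩ surj(p), `p ≥ 5`, `p ≡ 1 (mod 4)`: the rational even-branch main
conjecture from its Skinner–Urban half** — tower from surj(p) by Serre (`p ≥ 5`,
`forall_hasSurjectiveModNGaloisRep_pow_of_surj_of_five_le_or_semistable`, PROVED), `0 ≤ ord_p j` from
`TypeGOrd`, Kato's half `hKW`. [cite: Kato2004Asterisque, Thm. 17.4 (3) (p. 273)]
[cite: SerreAbelianLadic1968, Ch. IV §3.4, Lemma 3 (IV-23)] [cite: SkinnerUrban2014, Thm. 3.6.4, proof (p. 43)] -/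
theorem ClassX4Gord.chiBranchRatCharEqAt_of_katoHalf_of_ratLowerDvd_of_surj
    (hKW : Wuthrich2014.kato_halfEigenCharIdeal_dvd_cyclotomicPrime_of_surjective)
    (hX : ClassX4Gord W p) (hp5 : 5 ≤ p) (hsurj : Surj W p) (hE : ChiBranchRatLowerDvdAt W p) :
    ChiBranchRatCharEqAt W p :=
  chiBranchRatCharEqAt_of_katoHalf_of_ratLowerDvd hKW (padicValRat_j_nonneg_of_typeGOrd W p hX.typeGOrd)
    (W.forall_hasSurjectiveModNGaloisRep_pow_of_surj_of_five_le_or_semistable p hX.addv.1 (Or.inl hp5)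
      hsurj) hE

end Split

/-! ### §3 X4♯(G-ord) ∩ `I₀*`, `p ≥ 5`, `p ≡ 1 (mod 4)`: ends over `ChiBranchRatLowerDvdAt W p` + ONE unit coefficient -/

section Ends

variable {W : WeierstrassCurve ℚ} [W.IsElliptic] [W.IsGloballyMinimal] {p : ℕ} [hp : Fact p.Prime]

/-- **X4♯(G-ord) ∩ `I₀*` ∩ surj(p) ∩ non-anomalous, `p ≥ 5`, `p ≡ 1 (mod 4)`, non-CM, `r_an = 0`: the
LOWER half `ord_p #Ш_an ≤ ord_p #Ш` ⟸ the one-sided rational Skinner–Urban containment on the even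
branch (`ChiBranchRatLowerDvdAt W p`) + ONE unit coefficient** (+ Kato's half `hKW`, Pal `hPal`,
Delbourgo 2002 `hDel`, GZK, modularity; p249422's
`ClassX4Gord.missingLowerBoundAt_rankZero_of_ratCharEq_of_unitCoeff`). X4♯(G-ord) stays
CONSTRUCTION-SHAPED. [cite: SkinnerUrban2014, Cor. 3.6.2 (p. 42) (shape only)]
[cite: Kato2004Asterisque, Thm. 17.4 (3) (p. 273)] [cite: Delbourgo2002, Theorem (A), (B) (p. 40)]
[cite: Pal2012, Thm. 3.2] [cite: Miller2011LMS, Def. 1.1] -/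
theorem ClassX4Gord.missingLowerBoundAt_rankZero_of_ratLowerDvd_of_unitCoeff_of_surj
    (hKW : Wuthrich2014.kato_halfEigenCharIdeal_dvd_cyclotomicPrime_of_surjective)
    (hDel : Delbourgo2002.mainTheorem)
    (hPal : Pal2012.thm32_sqrt_mul_realPeriodRat_twist_eq_of_prime_one_mod_four)
    (hGZK : rank_eq_analyticRank_of_analyticRank_le_one) (hmod : hasEntireLFunction_rat)
    (hmodD : nonempty_modularParametrizationData)
    (hX : ClassX4Gord W p) (he : semistabilityIndex W p = 2) (hp5 : 5 ≤ p) (hp4 : p % 4 = 1)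
    (hcm : ¬ W.HasCM) (hr : W.analyticRank = 0) (hna : Delbourgo2002.ReductionNonAnomalous W p)
    (hsurj : Surj W p) (hE : ChiBranchRatLowerDvdAt W p)
    (hcert : ∀ (V : WeierstrassCurve ℚ) [V.IsElliptic] [V.IsGloballyMinimal] (C : VariableChange ℚ),
      GoodOrd V p → C • V.quadraticTwist (p : ℚ) = W →
      ∀ {N : ℕ} [NeZero N] (f : CuspForm (Gamma0 N) 2), IsNewformOf V f →
      ∀ ϖ : ℚ, (ϖ : ℝ) * V.realPeriodRat = plusPeriod f →
      ∃ n : ℕ, ‖PowerSeries.coeff n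
        (PowerSeries.C (ϖ : ℚ_[p]) * padicLFunctionBranch f (unitRoot V p : ℚ_[p]) (p / 2))‖ = 1) :
    MissingLowerBoundAt W p :=
  ClassX4Gord.missingLowerBoundAt_rankZero_of_ratCharEq_of_unitCoeff hDel hPal hGZK hmod hmodD hX he hp5
    hp4 hcm hr hna (hX.chiBranchRatCharEqAt_of_katoHalf_of_ratLowerDvd_of_surj hKW hp5 hsurj hE) hcert

/-- **X4♯(G-ord) ∩ `I₀*` ∩ surj(p) ∩ non-anomalous, `p ≥ 5`, `p ≡ 1 (mod 4)`, non-CM, `r_an = 0`: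
`BSD(E,p)` ⟸ the ONE-SIDED rational Skinner–Urban containment on the even branch of the twist
(`ChiBranchRatLowerDvdAt W p`, typed — the located gap in its native `Λ ⊗ ℚ_p` currency) + ONE unit
coefficient, and NOTHING ELSE typed**: Kato's half `hKW` serves both the upgrade (§2) and the UPPER half
(p249422's `ClassX4Gord.bsdp_rankZero_of_ratCharEq_of_unitCoeff_of_katoHalf`); Pal, Delbourgo 2002 /
1998 Prop. 4, GZK, modularity are the printed controls. Nothing booked; X4♯(G-ord) stays
CONSTRUCTION-SHAPED. [cite: SkinnerUrban2014, Cor. 3.6.2 (p. 42), Thm. 3.6.4 (p. 43) (shape only)]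
[cite: Kato2004Asterisque, Thm. 17.4 (3) (p. 273)] [cite: Delbourgo2002, Theorem (A), (B) (p. 40)]
[cite: Delbourgo1998, Prop. 4 (p. 144)] [cite: Pal2012, Thm. 3.2] [cite: Miller2011LMS, §1 and Def. 1.1] -/
theorem ClassX4Gord.bsdp_rankZero_of_ratLowerDvd_of_unitCoeff_of_surj
    (hKW : Wuthrich2014.kato_halfEigenCharIdeal_dvd_cyclotomicPrime_of_surjective)
    (hDel : Delbourgo2002.mainTheorem)
    (hDel98 : Delbourgo1998.prop4_rankZero_pow_dvd_constantCoeff)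
    (hPal : Pal2012.thm32_sqrt_mul_realPeriodRat_twist_eq_of_prime_one_mod_four)
    (hGZK : rank_eq_analyticRank_of_analyticRank_le_one) (hmod : hasEntireLFunction_rat)
    (hmodD : nonempty_modularParametrizationData)
    (hX : ClassX4Gord W p) (he : semistabilityIndex W p = 2) (hp5 : 5 ≤ p) (hp4 : p % 4 = 1)
    (hcm : ¬ W.HasCM) (hr : W.analyticRank = 0) (hna : Delbourgo2002.ReductionNonAnomalous W p)
    (hsurj : Surj W p) (hE : ChiBranchRatLowerDvdAt W p)
    (hcert : ∀ (V : WeierstrassCurve ℚ) [V.IsElliptic] [V.IsGloballyMinimal] (C : VariableChange ℚ),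
      GoodOrd V p → C • V.quadraticTwist (p : ℚ) = W →
      ∀ {N : ℕ} [NeZero N] (f : CuspForm (Gamma0 N) 2), IsNewformOf V f →
      ∀ ϖ : ℚ, (ϖ : ℝ) * V.realPeriodRat = plusPeriod f →
      ∃ n : ℕ, ‖PowerSeries.coeff n
        (PowerSeries.C (ϖ : ℚ_[p]) * padicLFunctionBranch f (unitRoot V p : ℚ_[p]) (p / 2))‖ = 1) :
    BSDp W p :=
  ClassX4Gord.bsdp_rankZero_of_ratCharEq_of_unitCoeff_of_katoHalf hDel hKW hDel98 hPal hGZK hmod hmodD hX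
    he hp5 hp4 hcm hr hna hsurj (hX.chiBranchRatCharEqAt_of_katoHalf_of_ratLowerDvd_of_surj hKW hp5 hsurj hE)
    hcert

end Ends

end Summit.BirchSwinnertonDyer.Rank1Residual.Additive

end
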